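import Literature.Probability.RandomPlanarGeometry.RadialBesselHarmonic
import Literature.Probability.RandomPlanarGeometry.RadialBesselBoundary
import HarnessLib

/-!
# Space-time exit functionals of the radial Bessel process: the PDE of LSW's Lemma 2.2

Topic `Probability/RandomPlanarGeometry`; theorems and two auxiliary definitions, sequel of
`RadialBesselHarmonic` and `RadialBesselBoundary`. For a time profile `F ∈ C¹(ℝ)` (`F, F'`
bounded, `F'` continuous) the **space-time exit functionals** of the SLE_κ radial Bessel process
(LSW (2002), (2.9)–(2.11)), `κ > 4`,

  `topST κ F θ t = E^θ[F(t - T); Y_T = 2π]`,  `botST κ F θ t = E^θ[F(t - T); Y_T = 0]`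

— the two halves of LSW's renewal formula (2.10) `h(θ, t) = E[h(Y_T, t - T)]` with data `F` on the
side `2π`, resp. `0` — satisfy:

* `hasDerivAt_topST_time` — `∂ₜ topST F = topST F'` (differentiation under `E`);
* `contDiffAt_topST_space`, `lswOp_topST_eq_zero` — for `F ∈ C²` (`F''` continuous bounded):
  `θ ↦ topST F θ t` is `C²` on `(0, 2π)` and **LSW's PDE (2.4) holds**:
  `(κ/2) ∂θθ + cot(θ/2) ∂θ - ∂ₜ = 0` (`RadialBesselHarmonic` with `ψ = F(t - ·)`);
* `abs_topST_sub_topST_le` — `|topST F θ t - topST F θ t'| ≤ C' |t - t'|`;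
* `continuousOn_topST_Icc` etc. — continuity of `θ ↦ topST F θ t` on `[0, 2π]` with the boundary
  values `0` at `0` and `F(t)` at `2π` (and `F(t)` at `0`, `0` at `2π` for `botST`), from
  `RadialBesselBoundary`;

and the same for `botST`. This is the regularity-and-PDE content of LSW's Lemma 2.2 for the
renewal extension `h = botST V + topST U` of boundary data `(V, U)`, proved from the diffusion
alone (no parabolic theory); the Neumann condition at `2π` is NOT a consequence (it is a property
of the data `U`, cf. LSW p. 6) and is not treated here.

## References

* G. F. Lawler, O. Schramm, W. Werner, *One-arm exponent for critical 2D percolation*, Electron.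
  J. Probab. 7 (2002), no. 2, §2, (2.4), (2.10), Lemma 2.2. [LawlerSchrammWernerEJP2002]
* G. F. Lawler, *Conformally Invariant Processes in the Plane*, AMS (2005), §1.11. [Lawler2005]
-/

noncomputable section

open MeasureTheory ProbabilityTheory Filter Topology Set
open scoped NNReal ENNReal

namespace Literature.Probability.RandomPlanarGeometry

namespace RadialLoewner

open Literature.Probability.Process Literature.Analysis.FunctionSpaces
open Literature.Probability.Percolation (lswOp)

variable {κ : ℝ≥0} {θ : ℝ}

/-- **`E^θ[F(t - T); Y_T = 2π]`**, the top half of LSW's renewal formula (2.10) with data `F`.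
[cite: LawlerSchrammWernerEJP2002, §2 (2.10)] -/
def topST (κ : ℝ≥0) (F : ℝ → ℝ) (θ t : ℝ) : ℝ := topExpect κ (fun x ↦ F (t - x)) θ

/-- **`E^θ[F(t - T); Y_T = 0]`**, the bottom half of (2.10). [cite: LawlerSchrammWernerEJP2002, §2 (2.10)] -/
def botST (κ : ℝ≥0) (F : ℝ → ℝ) (θ t : ℝ) : ℝ := botExpect κ (fun x ↦ F (t - x)) θ

/-! ### Differentiation under the expectation in the time variable -/

/-- **`∂ₜ E[F(t - T); S] = E[F'(t - T); S]`** for `F ∈ C¹` with `F, F'` bounded. [folklore] -/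
theorem hasDerivAt_integral_indicator_comp_sub {S : Set (ℝ≥0 → ℝ)} (hS : MeasurableSet S)
    {F F' : ℝ → ℝ} (hF : ∀ s, HasDerivAt F (F' s) s) (hF'c : Continuous F') {C C' : ℝ}
    (hFb : ∀ s, |F s| ≤ C) (hF'b : ∀ s, |F' s| ≤ C') (θ t : ℝ) :
    HasDerivAt (fun s ↦ ∫ ω, S.indicator (fun ω ↦ F (s - sleLifetimeReal κ θ ω)) ω ∂preWienerMeasure)
      (∫ ω, S.indicator (fun ω ↦ F' (t - sleLifetimeReal κ θ ω)) ω ∂preWienerMeasure) t := by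
  haveI := isProbabilityMeasure_preWienerMeasure'
  have hFc : Continuous F := continuous_iff_continuousAt.2 fun s ↦ (hF s).continuousAt
  have hC : 0 ≤ C := (abs_nonneg _).trans (hFb 0)
  have hmT := measurable_sleLifetimeReal κ θ
  have hmeasF : ∀ s, Measurable fun ω ↦ S.indicator (fun ω ↦ F (s - sleLifetimeReal κ θ ω)) ω := fun s ↦
    (hFc.measurable.comp (measurable_const.sub hmT)).indicator hS
  have h := hasDerivAt_integral_of_dominated_loc_of_deriv_le (μ := preWienerMeasure) (x₀ := t)
    (F := fun s ω ↦ S.indicator (fun ω ↦ F (s - sleLifetimeReal κ θ ω)) ω)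
    (F' := fun s ω ↦ S.indicator (fun ω ↦ F' (s - sleLifetimeReal κ θ ω)) ω)
    (bound := fun _ ↦ |C'|) (s := univ) univ_mem (Eventually.of_forall fun s ↦ (hmeasF s).aestronglyMeasurable)
    ?_ ?_ ?_ (integrable_const _) ?_
  · exact h.2
  · refine integrable_of_abs_le (hmeasF t) (C := C) fun ω ↦ ?_
    by_cases hω : ω ∈ S
    · simp only [indicator_of_mem hω]; exact hFb _
    · simp only [indicator_of_notMem hω, abs_zero]; exact hC
  · exact ((hF'c.measurable.comp (measurable_const.sub hmT)).indicator hS).aestronglyMeasurable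
  · refine Eventually.of_forall fun ω s _ ↦ ?_
    by_cases hω : ω ∈ S
    · simp only [indicator_of_mem hω, Real.norm_eq_abs]; exact (hF'b _).trans (le_abs_self _)
    · simp only [indicator_of_notMem hω, norm_zero]; exact abs_nonneg _
  · refine Eventually.of_forall fun ω s _ ↦ ?_
    by_cases hω : ω ∈ S
    · simp only [indicator_of_mem hω]
      have h1 := (hF (s - sleLifetimeReal κ θ ω)).comp s ((hasDerivAt_id s).sub_const (sleLifetimeReal κ θ ω))
      exact h1.congr_deriv (by simp)
    · simp only [indicator_of_notMem hω]
      exact hasDerivAt_const s 0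

section Time

variable {F F' : ℝ → ℝ} (hF : ∀ s, HasDerivAt F (F' s) s) (hF'c : Continuous F') {C C' : ℝ}
  (hFb : ∀ s, |F s| ≤ C) (hF'b : ∀ s, |F' s| ≤ C')
include hF hF'c hFb hF'b

/-- **`∂ₜ topST F = topST F'`.** [folklore] -/
theorem hasDerivAt_topST_time (θ t : ℝ) :
    HasDerivAt (fun s ↦ topST κ F θ s) (topST κ F' θ t) t :=
  hasDerivAt_integral_indicator_comp_sub (measurableSet_sleExitsTop κ θ) hF hF'c hFb hF'b θ t

/-- **`∂ₜ botST F = botST F'`.** [folklore] -/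
theorem hasDerivAt_botST_time (θ t : ℝ) :
    HasDerivAt (fun s ↦ botST κ F θ s) (botST κ F' θ t) t :=
  hasDerivAt_integral_indicator_comp_sub (measurableSet_sleExitsBot κ θ) hF hF'c hFb hF'b θ t

omit hF'c in
/-- **Lipschitz in time**: `|topST F θ t - topST F θ t'| ≤ C' |t - t'|`. [folklore] -/
theorem abs_topST_sub_le (θ t t' : ℝ) : |topST κ F θ t - topST κ F θ t'| ≤ C' * |t - t'| := by
  haveI := isProbabilityMeasure_preWienerMeasure'
  have hFc : Continuous F := continuous_iff_continuousAt.2 fun s ↦ (hF s).continuousAt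
  have hlipF : ∀ x y, |F x - F y| ≤ C' * |x - y| := fun x y ↦ by
    have hL : LipschitzWith ⟨C', (abs_nonneg _).trans (hF'b 0)⟩ F :=
      lipschitzWith_of_nnnorm_deriv_le (fun s ↦ (hF s).differentiableAt) fun s ↦ by
        rw [(hF s).deriv, ← NNReal.coe_le_coe, coe_nnnorm, Real.norm_eq_abs]; exact hF'b s
    have := hL.dist_le_mul x y
    rwa [Real.dist_eq, Real.dist_eq] at this
  have hC : 0 ≤ C := (abs_nonneg _).trans (hFb 0)
  have hmT := measurable_sleLifetimeReal κ θ
  have hint : ∀ s, Integrable (fun ω ↦ (sleExitsTop κ θ).indicator (fun ω ↦ F (s - sleLifetimeReal κ θ ω)) ω)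
      preWienerMeasure := fun s ↦
    integrable_of_abs_le ((hFc.measurable.comp (measurable_const.sub hmT)).indicator (measurableSet_sleExitsTop κ θ))
      (C := C) fun ω ↦ by
      by_cases hω : ω ∈ sleExitsTop κ θ
      · simp only [indicator_of_mem hω]; exact hFb _
      · simp only [indicator_of_notMem hω, abs_zero]; exact hC
  unfold topST topExpect
  rw [← integral_sub (hint t) (hint t')]
  calc |∫ ω, ((sleExitsTop κ θ).indicator (fun ω ↦ F (t - sleLifetimeReal κ θ ω)) ω -
        (sleExitsTop κ θ).indicator (fun ω ↦ F (t' - sleLifetimeReal κ θ ω)) ω) ∂preWienerMeasure|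
      ≤ ∫ ω, |(sleExitsTop κ θ).indicator (fun ω ↦ F (t - sleLifetimeReal κ θ ω)) ω -
        (sleExitsTop κ θ).indicator (fun ω ↦ F (t' - sleLifetimeReal κ θ ω)) ω| ∂preWienerMeasure :=
        abs_integral_le_integral_abs
    _ ≤ ∫ _, C' * |t - t'| ∂preWienerMeasure := by
        refine integral_mono_of_nonneg (Eventually.of_forall fun _ ↦ abs_nonneg _) (integrable_const _)
          (Eventually.of_forall fun ω ↦ ?_)
        by_cases hω : ω ∈ sleExitsTop κ θ
        · simp only [indicator_of_mem hω]
          refine (hlipF _ _).trans (le_of_eq ?_)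
          congr 1; congr 1; ring
        · simp only [indicator_of_notMem hω, sub_zero, abs_zero]
          exact mul_nonneg ((abs_nonneg _).trans (hF'b 0)) (abs_nonneg _)
    _ = C' * |t - t'| := by simp

omit hF'c in
/-- **Lipschitz in time** (bottom): `|botST F θ t - botST F θ t'| ≤ C' |t - t'|`. [folklore] -/
theorem abs_botST_sub_le (θ t t' : ℝ) : |botST κ F θ t - botST κ F θ t'| ≤ C' * |t - t'| := by
  haveI := isProbabilityMeasure_preWienerMeasure'
  have hFc : Continuous F := continuous_iff_continuousAt.2 fun s ↦ (hF s).continuousAt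
  have hlipF : ∀ x y, |F x - F y| ≤ C' * |x - y| := fun x y ↦ by
    have hL : LipschitzWith ⟨C', (abs_nonneg _).trans (hF'b 0)⟩ F :=
      lipschitzWith_of_nnnorm_deriv_le (fun s ↦ (hF s).differentiableAt) fun s ↦ by
        rw [(hF s).deriv, ← NNReal.coe_le_coe, coe_nnnorm, Real.norm_eq_abs]; exact hF'b s
    have := hL.dist_le_mul x y
    rwa [Real.dist_eq, Real.dist_eq] at this
  have hC : 0 ≤ C := (abs_nonneg _).trans (hFb 0)
  have hmT := measurable_sleLifetimeReal κ θ
  have hint : ∀ s, Integrable (fun ω ↦ (sleExitsBot κ θ).indicator (fun ω ↦ F (s - sleLifetimeReal κ θ ω)) ω)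
      preWienerMeasure := fun s ↦
    integrable_of_abs_le ((hFc.measurable.comp (measurable_const.sub hmT)).indicator (measurableSet_sleExitsBot κ θ))
      (C := C) fun ω ↦ by
      by_cases hω : ω ∈ sleExitsBot κ θ
      · simp only [indicator_of_mem hω]; exact hFb _
      · simp only [indicator_of_notMem hω, abs_zero]; exact hC
  unfold botST botExpect
  rw [← integral_sub (hint t) (hint t')]
  calc |∫ ω, ((sleExitsBot κ θ).indicator (fun ω ↦ F (t - sleLifetimeReal κ θ ω)) ω -
        (sleExitsBot κ θ).indicator (fun ω ↦ F (t' - sleLifetimeReal κ θ ω)) ω) ∂preWienerMeasure|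
      ≤ ∫ ω, |(sleExitsBot κ θ).indicator (fun ω ↦ F (t - sleLifetimeReal κ θ ω)) ω -
        (sleExitsBot κ θ).indicator (fun ω ↦ F (t' - sleLifetimeReal κ θ ω)) ω| ∂preWienerMeasure :=
        abs_integral_le_integral_abs
    _ ≤ ∫ _, C' * |t - t'| ∂preWienerMeasure := by
        refine integral_mono_of_nonneg (Eventually.of_forall fun _ ↦ abs_nonneg _) (integrable_const _)
          (Eventually.of_forall fun ω ↦ ?_)
        by_cases hω : ω ∈ sleExitsBot κ θ
        · simp only [indicator_of_mem hω]
          refine (hlipF _ _).trans (le_of_eq ?_)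
          congr 1; congr 1; ring
        · simp only [indicator_of_notMem hω, sub_zero, abs_zero]
          exact mul_nonneg ((abs_nonneg _).trans (hF'b 0)) (abs_nonneg _)
    _ = C' * |t - t'| := by simp

end Time

/-! ### The PDE in the space variable -/

/-- `a_{-φ} = -a_φ`. [folklore] -/
theorem topExpect_neg (κ : ℝ≥0) (φ : ℝ → ℝ) (y : ℝ) : topExpect κ (fun x ↦ -φ x) y = -topExpect κ φ y := by
  unfold topExpect
  rw [← integral_neg]
  refine integral_congr_ae (Eventually.of_forall fun ω ↦ ?_)
  by_cases hω : ω ∈ sleExitsTop κ y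
  · simp only [indicator_of_mem hω]
  · simp only [indicator_of_notMem hω, neg_zero]

/-- `b_{-φ} = -b_φ`. [folklore] -/
theorem botExpect_neg (κ : ℝ≥0) (φ : ℝ → ℝ) (y : ℝ) : botExpect κ (fun x ↦ -φ x) y = -botExpect κ φ y := by
  unfold botExpect
  rw [← integral_neg]
  refine integral_congr_ae (Eventually.of_forall fun ω ↦ ?_)
  by_cases hω : ω ∈ sleExitsBot κ y
  · simp only [indicator_of_mem hω]
  · simp only [indicator_of_notMem hω, neg_zero]

/-- The time-reversed profile `ψ = F(t - ·)` has `ψ' = -F'(t - ·)`. [folklore] -/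
theorem hasDerivAt_comp_const_sub {F F' : ℝ → ℝ} (hF : ∀ s, HasDerivAt F (F' s) s) (t x : ℝ) :
    HasDerivAt (fun x ↦ F (t - x)) (-F' (t - x)) x := by
  have h := (hF (t - x)).comp x ((hasDerivAt_const x t).sub (hasDerivAt_id x))
  exact h.congr_deriv (by simp)

section Space

variable (hκ : 4 < κ) {F F' : ℝ → ℝ} (hF : ∀ s, HasDerivAt F (F' s) s) (hF'c : Continuous F')
  {C C' : ℝ} (hFb : ∀ s, |F s| ≤ C) (hF'b : ∀ s, |F' s| ≤ C')
include hκ hF hF'c hFb hF'b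

/-- **`θ ↦ topST F θ t` is `C²` on `(0, 2π)`** (`F ∈ C¹`, `F, F'` bounded, `F'` continuous).
[cite: LawlerSchrammWernerEJP2002, §2 Lemma 2.2] -/
theorem contDiffAt_topST_space (t : ℝ) (hθ : θ ∈ Ioo 0 (2 * Real.pi)) :
    ContDiffAt ℝ 2 (fun θ ↦ topST κ F θ t) θ :=
  contDiffAt_topExpect (ψ := fun x ↦ F (t - x)) (ψ' := fun x ↦ -F' (t - x)) hκ
    (fun x ↦ hasDerivAt_comp_const_sub hF t x) ((hF'c.comp (continuous_const.sub continuous_id)).neg)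
    (C := C) (C' := C') (fun x ↦ hFb _) (fun x ↦ by rw [abs_neg]; exact hF'b _) hθ

/-- **`θ ↦ botST F θ t` is `C²` on `(0, 2π)`.** [cite: LawlerSchrammWernerEJP2002, §2 Lemma 2.2] -/
theorem contDiffAt_botST_space (t : ℝ) (hθ : θ ∈ Ioo 0 (2 * Real.pi)) :
    ContDiffAt ℝ 2 (fun θ ↦ botST κ F θ t) θ :=
  contDiffAt_botExpect (ψ := fun x ↦ F (t - x)) (ψ' := fun x ↦ -F' (t - x)) hκ
    (fun x ↦ hasDerivAt_comp_const_sub hF t x) ((hF'c.comp (continuous_const.sub continuous_id)).neg)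
    (C := C) (C' := C') (fun x ↦ hFb _) (fun x ↦ by rw [abs_neg]; exact hF'b _) hθ

/-- **`Λ₀ (topST F · t) = topST F' · t`** on `(0, 2π)`: the space operator applied to the top
functional is its time derivative. [cite: LawlerSchrammWernerEJP2002, §2 Lemma 2.2 (2.4)] -/
theorem expGenerator_topST (t : ℝ) (hθ : θ ∈ Ioo 0 (2 * Real.pi)) :
    expGenerator κ 0 (fun θ ↦ topST κ F θ t) θ = topST κ F' θ t := by
  have h := expGenerator_topExpect_eq (ψ := fun x ↦ F (t - x)) (ψ' := fun x ↦ -F' (t - x)) hκ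
    (fun x ↦ hasDerivAt_comp_const_sub hF t x) ((hF'c.comp (continuous_const.sub continuous_id)).neg)
    (C := C) (C' := C') (fun x ↦ hFb _) (fun x ↦ by rw [abs_neg]; exact hF'b _) hθ
  rw [topExpect_neg, neg_neg] at h
  exact h

/-- **`Λ₀ (botST F · t) = botST F' · t`** on `(0, 2π)`. [cite: LawlerSchrammWernerEJP2002, §2 Lemma 2.2 (2.4)] -/
theorem expGenerator_botST (t : ℝ) (hθ : θ ∈ Ioo 0 (2 * Real.pi)) :
    expGenerator κ 0 (fun θ ↦ botST κ F θ t) θ = botST κ F' θ t := by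
  have h := expGenerator_botExpect_eq (ψ := fun x ↦ F (t - x)) (ψ' := fun x ↦ -F' (t - x)) hκ
    (fun x ↦ hasDerivAt_comp_const_sub hF t x) ((hF'c.comp (continuous_const.sub continuous_id)).neg)
    (C := C) (C' := C') (fun x ↦ hFb _) (fun x ↦ by rw [abs_neg]; exact hF'b _) hθ
  rw [botExpect_neg, neg_neg] at h
  exact h

end Space

/-! ### Derivative functions and LSW's operator -/

/-- From `C²` at a point: the first two `deriv`s are genuine derivatives there. [folklore] -/
theorem hasDerivAt_deriv_of_contDiffAt {f : ℝ → ℝ} {x : ℝ} (hf : ContDiffAt ℝ 2 f x) :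
    HasDerivAt f (deriv f x) x ∧ HasDerivAt (deriv f) (deriv (deriv f) x) x := by
  have hev := hf.eventually (by simp)
  obtain ⟨v, hvsub, hvo, hxv⟩ := eventually_nhds_iff.1 hev
  have hv : v ∈ 𝓝 x := hvo.mem_nhds hxv
  have hfv : ContDiffOn ℝ 2 f v := fun y hy ↦ (hvsub y hy).contDiffWithinAt
  have hd : DifferentiableOn ℝ f v := hfv.differentiableOn (by norm_num)
  have hd' : DifferentiableOn ℝ (deriv f) v := (hfv.deriv_of_isOpen hvo (m := 1) (by norm_num)).differentiableOn
    (by norm_num)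
  exact ⟨(hd.differentiableAt hv).hasDerivAt, (hd'.differentiableAt hv).hasDerivAt⟩

/-- **LSW's operator vanishes**: if `θ ↦ g θ t` is `C²` at `θ` with `Λ₀ (g · t) θ = ∂ₜ g`, then
`lswOp κ θ (∂θθ g) (∂θ g) (∂ₜ g) = 0` with `∂θ g = deriv`, `∂θθ g = deriv deriv`. [folklore] -/
theorem lswOp_eq_zero_of_expGenerator {g : ℝ → ℝ} {gt : ℝ} (hgen : expGenerator κ 0 g θ = gt) :
    lswOp κ θ (deriv (deriv g) θ) (deriv g θ) gt = 0 := by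
  rw [expGenerator_apply, iteratedDeriv_succ, iteratedDeriv_one, zero_mul, add_zero] at hgen
  rw [lswOp, ← hgen]
  ring

/-! ### The renewal extension of boundary data `(V, U)` -/

/-- **The renewal extension** `g(θ, t) = E^θ[V(t - T); Y_T = 0] + E^θ[U(t - T); Y_T = 2π]` of time
profiles `V` (data on the side `0`) and `U` (data on the side `2π`), LSW's (2.10)
`h(θ, t) = E[h(Y_T, t - T)]`, extended to `θ ≤ 0` by `V(t)` and to `θ ≥ 2π` by `U(t)`.
[cite: LawlerSchrammWernerEJP2002, §2 (2.10)] -/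
def renewalST (κ : ℝ≥0) (V U : ℝ → ℝ) (θ t : ℝ) : ℝ :=
  if θ ≤ 0 then V t else if 2 * Real.pi ≤ θ then U t else botST κ V θ t + topST κ U θ t

variable {V U : ℝ → ℝ}

/-- Inside the strip the extension is `botST V + topST U`. [folklore] -/
theorem renewalST_of_mem (κ : ℝ≥0) (V U : ℝ → ℝ) (hθ : θ ∈ Ioo 0 (2 * Real.pi)) (t : ℝ) :
    renewalST κ V U θ t = botST κ V θ t + topST κ U θ t := by
  rw [renewalST, if_neg (not_le.2 hθ.1), if_neg (not_le.2 hθ.2)]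

/-- The value at `θ = 0`. [folklore] -/
theorem renewalST_zero (κ : ℝ≥0) (V U : ℝ → ℝ) (t : ℝ) : renewalST κ V U 0 t = V t := by
  rw [renewalST, if_pos le_rfl]

/-- The value at `θ = 2π`. [folklore] -/
theorem renewalST_two_pi (κ : ℝ≥0) (V U : ℝ → ℝ) (t : ℝ) : renewalST κ V U (2 * Real.pi) t = U t := by
  rw [renewalST, if_neg (not_le.2 (by positivity)), if_pos le_rfl]

/-- Near an interior point, `renewalST = botST V + topST U` as functions of `θ`. [folklore] -/
theorem renewalST_eventuallyEq (κ : ℝ≥0) (V U : ℝ → ℝ) (hθ : θ ∈ Ioo 0 (2 * Real.pi)) (t : ℝ) :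
    (fun x ↦ renewalST κ V U x t) =ᶠ[𝓝 θ] fun x ↦ botST κ V x t + topST κ U x t := by
  filter_upwards [isOpen_Ioo.mem_nhds hθ] with x hx
  exact renewalST_of_mem κ V U hx t

/-- **Bounds**: `0 ≤ V, U ≤ 1` give `renewalST ∈ [0, 1]` (`P[Y_T = 0] + P[Y_T = 2π] = 1`). [folklore] -/
theorem renewalST_mem_Icc (hκ : 4 < κ) (hVm : Measurable V) (hUm : Measurable U)
    (hV : ∀ s, V s ∈ Icc (0 : ℝ) 1) (hU : ∀ s, U s ∈ Icc (0 : ℝ) 1) (θ t : ℝ) :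
    renewalST κ V U θ t ∈ Icc (0 : ℝ) 1 := by
  haveI := isProbabilityMeasure_preWienerMeasure'
  by_cases h0 : θ ≤ 0
  · rw [renewalST, if_pos h0]; exact hV t
  by_cases h2 : 2 * Real.pi ≤ θ
  · rw [renewalST, if_neg h0, if_pos h2]; exact hU t
  have hθ : θ ∈ Ioo 0 (2 * Real.pi) := ⟨not_le.1 h0, not_le.1 h2⟩
  rw [renewalST_of_mem κ V U hθ]
  have hmT := measurable_sleLifetimeReal κ θ
  set f : (ℝ≥0 → ℝ) → ℝ := fun ω ↦ (sleExitsBot κ θ).indicator (fun ω ↦ V (t - sleLifetimeReal κ θ ω)) ω with hf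
  set g : (ℝ≥0 → ℝ) → ℝ := fun ω ↦ (sleExitsTop κ θ).indicator (fun ω ↦ U (t - sleLifetimeReal κ θ ω)) ω with hg
  have hfi : Integrable f preWienerMeasure :=
    integrable_of_abs_le ((hVm.comp (measurable_const.sub hmT)).indicator (measurableSet_sleExitsBot κ θ)) (C := 1)
      fun ω ↦ by
      by_cases hω : ω ∈ sleExitsBot κ θ
      · simp only [hf, indicator_of_mem hω]; rw [abs_of_nonneg (hV _).1]; exact (hV _).2
      · simp only [hf, indicator_of_notMem hω, abs_zero]; exact zero_le_one
  have hgi : Integrable g preWienerMeasure :=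
    integrable_of_abs_le ((hUm.comp (measurable_const.sub hmT)).indicator (measurableSet_sleExitsTop κ θ)) (C := 1)
      fun ω ↦ by
      by_cases hω : ω ∈ sleExitsTop κ θ
      · simp only [hg, indicator_of_mem hω]; rw [abs_of_nonneg (hU _).1]; exact (hU _).2
      · simp only [hg, indicator_of_notMem hω, abs_zero]; exact zero_le_one
  have hsum : botST κ V θ t + topST κ U θ t = ∫ ω, (f ω + g ω) ∂preWienerMeasure := by
    rw [integral_add hfi hgi]; rfl
  rw [hsum]
  have hlow : ∀ ω, 0 ≤ f ω + g ω := fun ω ↦ by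
    refine add_nonneg ?_ ?_
    · by_cases hω : ω ∈ sleExitsBot κ θ
      · simp only [hf, indicator_of_mem hω]; exact (hV _).1
      · simp only [hf, indicator_of_notMem hω]; exact le_rfl
    · by_cases hω : ω ∈ sleExitsTop κ θ
      · simp only [hg, indicator_of_mem hω]; exact (hU _).1
      · simp only [hg, indicator_of_notMem hω]; exact le_rfl
  have hup : ∀ ω, f ω + g ω ≤ (sleExitsBot κ θ).indicator 1 ω + (sleExitsTop κ θ).indicator 1 ω := fun ω ↦ by
    refine add_le_add ?_ ?_
    · by_cases hω : ω ∈ sleExitsBot κ θ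
      · simp only [hf, indicator_of_mem hω, Pi.one_apply]; exact (hV _).2
      · simp only [hf, indicator_of_notMem hω]; exact le_rfl
    · by_cases hω : ω ∈ sleExitsTop κ θ
      · simp only [hg, indicator_of_mem hω, Pi.one_apply]; exact (hU _).2
      · simp only [hg, indicator_of_notMem hω]; exact le_rfl
  constructor
  · exact integral_nonneg hlow
  · have h1 := measureReal_sleExitsTop_add_sleExitsBot hκ hθ
    calc ∫ ω, (f ω + g ω) ∂preWienerMeasure
        ≤ ∫ ω, ((sleExitsBot κ θ).indicator 1 ω + (sleExitsTop κ θ).indicator 1 ω) ∂preWienerMeasure :=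
          integral_mono (hfi.add hgi) (((integrable_const 1).indicator (measurableSet_sleExitsBot κ θ)).add
            ((integrable_const 1).indicator (measurableSet_sleExitsTop κ θ))) hup
      _ = 1 := by
          rw [integral_add ((integrable_const 1).indicator (measurableSet_sleExitsBot κ θ))
            ((integrable_const 1).indicator (measurableSet_sleExitsTop κ θ)),
            integral_indicator_one (measurableSet_sleExitsBot κ θ), integral_indicator_one (measurableSet_sleExitsTop κ θ)]
          linarith

section Regularity

variable (hκ : 4 < κ) {V V' U U' : ℝ → ℝ} (hV : ∀ s, HasDerivAt V (V' s) s) (hV'c : Continuous V')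
  (hU : ∀ s, HasDerivAt U (U' s) s) (hU'c : Continuous U') {CV CV' CU CU' : ℝ}
  (hVb : ∀ s, |V s| ≤ CV) (hV'b : ∀ s, |V' s| ≤ CV') (hUb : ∀ s, |U s| ≤ CU) (hU'b : ∀ s, |U' s| ≤ CU')
include hκ hV hV'c hU hU'c hVb hV'b hUb hU'b

omit hV'c hU'c hV'b hU'b in
/-- **Continuity in `θ` on the closed interval `[0, 2π]`** for each `t`, with the boundary values
`V(t)` at `0` and `U(t)` at `2π` (`RadialBesselContinuity` inside, `RadialBesselBoundary` at the
ends). [cite: LawlerSchrammWernerEJP2002, §2 Lemma 2.2] -/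
theorem continuousOn_renewalST_Icc (t : ℝ) :
    ContinuousOn (fun θ ↦ renewalST κ V U θ t) (Icc 0 (2 * Real.pi)) := by
  have h2π : (0 : ℝ) < 2 * Real.pi := by positivity
  have hVc : Continuous V := continuous_iff_continuousAt.2 fun s ↦ (hV s).continuousAt
  have hUc : Continuous U := continuous_iff_continuousAt.2 fun s ↦ (hU s).continuousAt
  have hφV : Continuous fun x ↦ V (t - x) := hVc.comp (continuous_const.sub continuous_id)
  have hφU : Continuous fun x ↦ U (t - x) := hUc.comp (continuous_const.sub continuous_id)
  have hφVb : ∀ x, |V (t - x)| ≤ CV := fun x ↦ hVb _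
  have hφUb : ∀ x, |U (t - x)| ≤ CU := fun x ↦ hUb _
  -- the inside function and its limits at the ends
  have hin : ContinuousOn (fun θ ↦ botST κ V θ t + topST κ U θ t) (Ioo 0 (2 * Real.pi)) :=
    (continuousOn_botExpect hκ hφV hφVb).add (continuousOn_topExpect hκ hφU hφUb)
  have hlim0 : Tendsto (fun θ ↦ botST κ V θ t + topST κ U θ t) (𝓝[>] 0) (𝓝 (V t)) := by
    have h1 := tendsto_botExpect_nhdsGT_zero hκ hφV hφVb
    have h2 := tendsto_topExpect_nhdsGT_zero hκ (φ := fun x ↦ U (t - x)) hφUb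
    simp only [sub_zero] at h1
    have h := h1.add h2
    rw [add_zero] at h
    exact h
  have hlim2 : Tendsto (fun θ ↦ botST κ V θ t + topST κ U θ t) (𝓝[<] (2 * Real.pi)) (𝓝 (U t)) := by
    have h1 := tendsto_botExpect_nhdsLT_two_pi hκ (φ := fun x ↦ V (t - x)) hφVb
    have h2 := tendsto_topExpect_nhdsLT_two_pi hκ hφU hφUb
    simp only [sub_zero] at h2
    have h := h1.add h2
    rw [zero_add] at h
    exact h
  intro θ hθ
  rcases eq_or_lt_of_le hθ.1 with h0 | h0
  · -- `θ = 0`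
    subst h0
    rw [continuousWithinAt_Icc_iff_Ici h2π, ← continuousWithinAt_Ioi_iff_Ici, ContinuousWithinAt,
      renewalST_zero]
    refine hlim0.congr' ?_
    filter_upwards [Ioo_mem_nhdsGT h2π] with x hx
    exact (renewalST_of_mem κ V U hx t).symm
  rcases eq_or_lt_of_le hθ.2 with h2 | h2
  · -- `θ = 2π`
    subst h2
    rw [continuousWithinAt_Icc_iff_Iic h2π, ← continuousWithinAt_Iio_iff_Iic, ContinuousWithinAt,
      renewalST_two_pi]
    refine hlim2.congr' ?_
    filter_upwards [Ioo_mem_nhdsLT h2π] with x hx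
    exact (renewalST_of_mem κ V U hx t).symm
  · -- interior
    have hmem : θ ∈ Ioo 0 (2 * Real.pi) := ⟨h0, h2⟩
    exact ((hin.continuousAt (isOpen_Ioo.mem_nhds hmem)).congr_of_eventuallyEq
      (renewalST_eventuallyEq κ V U hmem t)).continuousWithinAt

omit hκ hV'c hU'c in
/-- **Lipschitz in `t`**, uniformly in `θ`: `|g(θ, t) - g(θ, t')| ≤ (C'_V + C'_U) |t - t'|`. [folklore] -/
theorem abs_renewalST_sub_le (θ t t' : ℝ) :
    |renewalST κ V U θ t - renewalST κ V U θ t'| ≤ (CV' + CU') * |t - t'| := by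
  have hCV' : 0 ≤ CV' := (abs_nonneg _).trans (hV'b 0)
  have hCU' : 0 ≤ CU' := (abs_nonneg _).trans (hU'b 0)
  have hlip : ∀ {F F' : ℝ → ℝ} {C' : ℝ}, (∀ s, HasDerivAt F (F' s) s) → (∀ s, |F' s| ≤ C') →
      ∀ x y, |F x - F y| ≤ C' * |x - y| := by
    intro F F' C' hF hF'b x y
    have hL : LipschitzWith ⟨C', (abs_nonneg _).trans (hF'b 0)⟩ F :=
      lipschitzWith_of_nnnorm_deriv_le (fun s ↦ (hF s).differentiableAt) fun s ↦ by
        rw [(hF s).deriv, ← NNReal.coe_le_coe, coe_nnnorm, Real.norm_eq_abs]; exact hF'b s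
    have := hL.dist_le_mul x y
    rwa [Real.dist_eq, Real.dist_eq] at this
  by_cases h0 : θ ≤ 0
  · simp only [renewalST, if_pos h0]
    refine (hlip hV hV'b t t').trans ?_
    nlinarith [abs_nonneg (t - t')]
  by_cases h2 : 2 * Real.pi ≤ θ
  · simp only [renewalST, if_neg h0, if_pos h2]
    refine (hlip hU hU'b t t').trans ?_
    nlinarith [abs_nonneg (t - t')]
  have hθ : θ ∈ Ioo 0 (2 * Real.pi) := ⟨not_le.1 h0, not_le.1 h2⟩
  rw [renewalST_of_mem κ V U hθ, renewalST_of_mem κ V U hθ]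
  have h1 := abs_botST_sub_le (κ := κ) hV hVb hV'b θ t t'
  have h2 := abs_topST_sub_le (κ := κ) hU hUb hU'b θ t t'
  calc |botST κ V θ t + topST κ U θ t - (botST κ V θ t' + topST κ U θ t')|
      = |(botST κ V θ t - botST κ V θ t') + (topST κ U θ t - topST κ U θ t')| := by ring_nf
    _ ≤ CV' * |t - t'| + CU' * |t - t'| := (abs_add_le _ _).trans (add_le_add h1 h2)
    _ = (CV' + CU') * |t - t'| := by ring

omit hV'c hU'c in
/-- **Joint continuity on the closed strip `[0, 2π] × ℝ`** (Lipschitz in `t` uniformly in `θ`, and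
continuous in `θ` for each `t`). [cite: LawlerSchrammWernerEJP2002, §2 Lemma 2.2] -/
theorem continuousOn_renewalST_prod :
    ContinuousOn (fun p : ℝ × ℝ ↦ renewalST κ V U p.1 p.2) (Icc 0 (2 * Real.pi) ×ˢ univ) := by
  set L := CV' + CU' + 1 with hL
  have hL0 : 0 < L := by
    have hCV' : 0 ≤ CV' := (abs_nonneg _).trans (hV'b 0)
    have hCU' : 0 ≤ CU' := (abs_nonneg _).trans (hU'b 0)
    rw [hL]; linarith
  rintro ⟨θ₀, t₀⟩ ⟨hθ₀, -⟩
  rw [Metric.continuousWithinAt_iff]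
  intro ε hε
  obtain ⟨δ, hδ, hδε⟩ := Metric.continuousWithinAt_iff.1
    (continuousOn_renewalST_Icc hκ hV hU hVb hUb t₀ θ₀ hθ₀) (ε / 2) (half_pos hε)
  refine ⟨min δ (ε / (2 * L)), lt_min hδ (by positivity), ?_⟩
  rintro ⟨θ, t⟩ ⟨hθ, -⟩ hdist
  rw [Prod.dist_eq, max_lt_iff] at hdist
  obtain ⟨hdθ, hdt⟩ := hdist
  have hA : dist (renewalST κ V U θ t₀) (renewalST κ V U θ₀ t₀) < ε / 2 :=
    hδε hθ (lt_of_lt_of_le hdθ (min_le_left _ _))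
  have hB : |renewalST κ V U θ t - renewalST κ V U θ t₀| < ε / 2 := by
    have h := abs_renewalST_sub_le (κ := κ) hV hU hVb hV'b hUb hU'b θ t t₀
    have hdt' : |t - t₀| < ε / (2 * L) := by
      have := lt_of_lt_of_le hdt (min_le_right _ _); rwa [Real.dist_eq] at this
    calc |renewalST κ V U θ t - renewalST κ V U θ t₀| ≤ (CV' + CU') * |t - t₀| := h
      _ ≤ L * |t - t₀| := mul_le_mul_of_nonneg_right (by rw [hL]; linarith) (abs_nonneg _)
      _ < L * (ε / (2 * L)) := mul_lt_mul_of_pos_left hdt' hL0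
      _ = ε / 2 := by field_simp
  rw [Real.dist_eq] at hA ⊢
  calc |renewalST κ V U θ t - renewalST κ V U θ₀ t₀|
      = |(renewalST κ V U θ t - renewalST κ V U θ t₀) + (renewalST κ V U θ t₀ - renewalST κ V U θ₀ t₀)| := by ring_nf
    _ ≤ |renewalST κ V U θ t - renewalST κ V U θ t₀| + |renewalST κ V U θ t₀ - renewalST κ V U θ₀ t₀| :=
        abs_add_le _ _
    _ < ε := by linarith

/-- **`θ ↦ g(θ, t)` is `C²` at interior points.** [cite: LawlerSchrammWernerEJP2002, §2 Lemma 2.2] -/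
theorem contDiffAt_renewalST (t : ℝ) (hθ : θ ∈ Ioo 0 (2 * Real.pi)) :
    ContDiffAt ℝ 2 (fun x ↦ renewalST κ V U x t) θ :=
  (((contDiffAt_botST_space hκ hV hV'c hVb hV'b t hθ).add
    (contDiffAt_topST_space hκ hU hU'c hUb hU'b t hθ)).congr_of_eventuallyEq (renewalST_eventuallyEq κ V U hθ t))

/-- **Space derivatives exist** at interior points (first). [folklore] -/
theorem hasDerivAt_renewalST_space (t : ℝ) (hθ : θ ∈ Ioo 0 (2 * Real.pi)) :
    HasDerivAt (fun x ↦ renewalST κ V U x t) (deriv (fun x ↦ renewalST κ V U x t) θ) θ :=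
  (hasDerivAt_deriv_of_contDiffAt (contDiffAt_renewalST hκ hV hV'c hU hU'c hVb hV'b hUb hU'b t hθ)).1

/-- **Space derivatives exist** at interior points (second). [folklore] -/
theorem hasDerivAt_deriv_renewalST_space (t : ℝ) (hθ : θ ∈ Ioo 0 (2 * Real.pi)) :
    HasDerivAt (deriv fun x ↦ renewalST κ V U x t) (deriv (deriv fun x ↦ renewalST κ V U x t) θ) θ :=
  (hasDerivAt_deriv_of_contDiffAt (contDiffAt_renewalST hκ hV hV'c hU hU'c hVb hV'b hUb hU'b t hθ)).2

omit hκ in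
/-- **The time derivative** at interior points: `∂ₜ g = botST V' + topST U'`. [folklore] -/
theorem hasDerivAt_renewalST_time (hθ : θ ∈ Ioo 0 (2 * Real.pi)) (t : ℝ) :
    HasDerivAt (fun s ↦ renewalST κ V U θ s) (botST κ V' θ t + topST κ U' θ t) t := by
  have heq : (fun s ↦ renewalST κ V U θ s) = fun s ↦ botST κ V θ s + topST κ U θ s :=
    funext fun s ↦ renewalST_of_mem κ V U hθ s
  rw [heq]
  exact (hasDerivAt_botST_time hV hV'c hVb hV'b θ t).add (hasDerivAt_topST_time hU hU'c hUb hU'b θ t)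

/-- **LSW's PDE (2.4) for the renewal extension**: at interior points,
`(κ/2) ∂θθ g + cot(θ/2) ∂θ g - ∂ₜ g = 0`. [cite: LawlerSchrammWernerEJP2002, §2 Lemma 2.2 (2.4)] -/
theorem lswOp_renewalST (t : ℝ) (hθ : θ ∈ Ioo 0 (2 * Real.pi)) :
    lswOp κ θ (deriv (deriv fun x ↦ renewalST κ V U x t) θ) (deriv (fun x ↦ renewalST κ V U x t) θ)
      (botST κ V' θ t + topST κ U' θ t) = 0 := by
  refine lswOp_eq_zero_of_expGenerator ?_
  rw [expGenerator_congr (renewalST_eventuallyEq κ V U hθ t)]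
  have hb : ContDiffOn ℝ 2 (fun x ↦ botST κ V x t) (Ioo 0 (2 * Real.pi)) := fun y hy ↦
    (contDiffAt_botST_space hκ hV hV'c hVb hV'b t hy).contDiffWithinAt
  have ht : ContDiffOn ℝ 2 (fun x ↦ topST κ U x t) (Ioo 0 (2 * Real.pi)) := fun y hy ↦
    (contDiffAt_topST_space hκ hU hU'c hUb hU'b t hy).contDiffWithinAt
  rw [expGenerator_add_of_contDiffOn isOpen_Ioo hb ht hθ, expGenerator_botST hκ hV hV'c hVb hV'b t hθ,
    expGenerator_topST hκ hU hU'c hUb hU'b t hθ]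

end Regularity

end RadialLoewner

end Literature.Probability.RandomPlanarGeometry
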